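import Mathlib
import Summits.ResolutionOfSingularities.ResolutionOfSingularities.Theorems.WeightedInvariantLocalWeightedDropNCResSurfGraphPointData
import Summits.ResolutionOfSingularities.ResolutionOfSingularities.Theorems.WeightedInvariantLocalWeightedDropBlowupScaling
import Summits.ResolutionOfSingularities.ResolutionOfSingularities.Theorems.WeightedInvariantLocalWeightedDropNCResPhaseAssembly

/-!
# `WeightedInvariant.LocalWeightedDrop`: NC-resolution settings for the TOT₂ line — GRAPH SURFACES, part 21: THE PLANE SHADOW UNDER THE POINT MOVE, AND THE NON-NORMAL-CROSSING PHASE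

Crux item stmt-ResolutionOfSingularities-8899 `LocalWeightedDrop` (route `ResolutionOfSingularities/WeightedInvariant`), ENGINE skeleton v34/v35, residual
`stub_wildWideApexFourStartsWon`; res-L1-w43-strat-1's line `directrix-cut` v3f, piece PL₃, sub-skeleton `pl3_split_v1` (7519a9009475ab47), stub
`stub_apexPlaneSurfaceThree` = the SURFACE sub-case `ApexPlaneSurfaceExit`, reduced (…NCResSurfGraphRegime, p557720) to the loop `SurfLoop k m`.
Design memo `L/res-L1-w43-stub-4/g6/SURFLOOP-DESIGN.md`.  [OURS · L1 W4.3 · chain w43 · seat res-L1-w43-stub-4 gen 6; def-free, on parts 1–19 and 22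
(…NCResSurfGraph*), res-L1-w43-stub-1's S-SET and res-L1-w43-lead-1's boundary bookkeeping (…NCResRegimeTransport); the count game is the programme's
own; nothing here is a statement of any manuscript; AI-produced, gate-checked, weaker than expert review.]

THE NON-NORMAL-CROSSING PHASE OF THE LOOP (memo §1).  The shadow `x₀^{[a∈E]} x₁^{[b∈E]} ∏ ψ_l` of a loop state is a plane germ; the two slices
of its plane cobordant chart at `(c_a, c_b)` are EXACTLY `x₀ ·` the products of the successor traces of the point move read at `a`, resp. `b`
(`shadow_pointSucc_dvd`, `…_dvd_pow`), so the successor's shadow divides a power of the slice germ that the drop clause (iii) of the tree theorem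
`PlaneGermNonNCCountRad` (`stub_planeCountRadical`: the radical-monotone count `ν` of non-normal-crossing infinitely near points, Hartshorne V.3.9 in
chart form) names; reading each answer at THAT slot makes `ν(shadow)` drop (`pointMove_clause_shadow`), and `DWinsTo.of_wfMeasure` gives the phase:
**`dWinsTo_ncShadow`** — from every valid loop state the mover forces «smaller head, or a valid loop state of the same head whose shadow is a normal
crossing».  No curve moves and no automorphism invariance of `ν` are needed in this phase.
-/

set_option linter.dupNamespace false -- mandated namespace of this single-conjunct summit

noncomputable section

namespace Summit.ResolutionOfSingularities.ResolutionOfSingularities.Theorems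

namespace TameFourTupleDrop

namespace GraphSurf

namespace SurfDatum

open MvPowerSeries Literature.AlgebraicGeometry.Resolution

variable {k : Type} [Field k] {m : ℕ}

/-- The swapped trace vanishes iff the trace does. -/
theorem subst_sw_eq_zero_iff (ψ : MvPowerSeries (Fin 2) k) :
    subst (![X 1, X 0] : Fin 2 → MvPowerSeries (Fin 2) k) ψ = 0 ↔ ψ = 0 := by
  constructor
  · intro h
    rw [← subst_swap_subst_swap ψ, h, ← coe_substAlgHom TOT2Curve.hasSubst_swap, map_zero]
  · rintro rfl
    rw [← coe_substAlgHom TOT2Curve.hasSubst_swap, map_zero]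

open Classical in
/-- THE SHADOW OF THE SWAPPED READING is the swapped shadow. -/
theorem shadow_swap (σ : SurfDatum k m) : σ.swap.shadow = subst (![X 1, X 0] : Fin 2 → MvPowerSeries (Fin 2) k) σ.shadow := by
  rw [shadow, shadow, off_swap, ← coe_substAlgHom TOT2Curve.hasSubst_swap, map_mul, map_mul, map_pow, map_pow, map_prod, coe_substAlgHom,
    subst_X TOT2Curve.hasSubst_swap, subst_X TOT2Curve.hasSubst_swap]
  simp only [swap_δ, swap_a, swap_bLetter, swap_ψ, Matrix.cons_val_zero, Matrix.cons_val_one]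
  have hS : (σ.off.filter fun l => subst (![X 1, X 0] : Fin 2 → MvPowerSeries (Fin 2) k) (σ.ψ l) ≠ 0) = σ.off.filter fun l => σ.ψ l ≠ 0 :=
    Finset.filter_congr fun l _ => by rw [ne_eq, subst_sw_eq_zero_iff]
  rw [hS]
  ring

open Classical in
/-- The shadow of a valid state is non-zero. -/
theorem shadow_ne_zero (σ : SurfDatum k m) : σ.shadow ≠ 0 := by
  rw [shadow]
  refine mul_ne_zero (mul_ne_zero (pow_ne_zero _ (FormalCoordChange.X_ne_zero' _)) (pow_ne_zero _ (FormalCoordChange.X_ne_zero' _))) ?_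
  rw [Finset.prod_ne_zero_iff]
  intro l hl
  exact (Finset.mem_filter.mp hl).2

/-! ### The two slices of the plane chart -/

/-- The slot-`0` reading family `(λ x₀, x₀(μ + x₁))` may be substituted. -/
theorem hasSubst_cb (lam mu : k) : HasSubst (![C lam * X 0, X 0 * (C mu + X 1)] : Fin 2 → MvPowerSeries (Fin 2) k) :=
  hasSubst_of_constantCoeff_zero fun t => by fin_cases t <;> simp [constantCoeff_X]

/-- THE SLOT-`0` SLICE OF THE PLANE CHART at `c̄`: `P(c̄₀ x₀, x₀ (c̄₁ + x₁))`. -/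
theorem slice_zero_chart_eq (cb : Fin 2 → k) (P : MvPowerSeries (Fin 2) k) :
    subst (fun j : Fin 3 => if j = (0 : Fin 2).succ then (0 : MvPowerSeries (Fin 2) k) else X (Fin.predAbove 0 j))
        (subst (CobordantChart.chart (fun _ : Fin 2 => 1) cb) P) =
      subst (![C (cb 0) * X 0, X 0 * (C (cb 1) + X 1)] : Fin 2 → MvPowerSeries (Fin 2) k) P := by
  have hS : HasSubst (![X 0, 0, X 1] : Fin 3 → MvPowerSeries (Fin 2) k) :=
    hasSubst_of_constantCoeff_zero fun j => by fin_cases j <;> simp [constantCoeff_X]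
  rw [BlowupScaling.slice_zero_eq, subst_comp_subst_apply (CobordantChart.hasSubst_chart _ cb (BlowupScaling.chart_convention cb)) hS]
  congr 1
  funext s
  simp only [CobordantChart.chart_apply, pow_one, subst_mul hS, subst_add hS, subst_C, subst_X hS]
  fin_cases s
  · simp
    ring
  · simp

/-- THE SLOT-`1` SLICE OF THE PLANE CHART at `c̄`: `P(x₀ (c̄₀ + x₁), c̄₁ x₀)`. -/
theorem slice_one_chart_eq (cb : Fin 2 → k) (P : MvPowerSeries (Fin 2) k) :
    subst (fun j : Fin 3 => if j = (1 : Fin 2).succ then (0 : MvPowerSeries (Fin 2) k) else X (Fin.predAbove 1 j))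
        (subst (CobordantChart.chart (fun _ : Fin 2 => 1) cb) P) =
      subst (![X 0 * (C (cb 0) + X 1), C (cb 1) * X 0] : Fin 2 → MvPowerSeries (Fin 2) k) P := by
  have hS : HasSubst (![X 0, X 1, 0] : Fin 3 → MvPowerSeries (Fin 2) k) :=
    hasSubst_of_constantCoeff_zero fun j => by fin_cases j <;> simp [constantCoeff_X]
  rw [BlowupScaling.slice_one_eq, subst_comp_subst_apply (CobordantChart.hasSubst_chart _ cb (BlowupScaling.chart_convention cb)) hS]
  congr 1
  funext s
  simp only [CobordantChart.chart_apply, pow_one, subst_mul hS, subst_add hS, subst_C, subst_X hS]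
  fin_cases s
  · simp
  · simp
    ring

/-- The slot-`1` reading is the slot-`0` reading of the swapped germ with the roles of `λ, μ` exchanged. -/
theorem subst_cbOne_eq_subst_cb_swap (lam mu : k) (P : MvPowerSeries (Fin 2) k) :
    subst (![X 0 * (C lam + X 1), C mu * X 0] : Fin 2 → MvPowerSeries (Fin 2) k) P =
      subst (![C mu * X 0, X 0 * (C lam + X 1)] : Fin 2 → MvPowerSeries (Fin 2) k)
        (subst (![X 1, X 0] : Fin 2 → MvPowerSeries (Fin 2) k) P) := by
  rw [subst_comp_subst_apply TOT2Curve.hasSubst_swap (hasSubst_cb mu lam)]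
  congr 1
  funext t
  fin_cases t
  · simp [subst_X (hasSubst_cb mu lam)]
  · simp [subst_X (hasSubst_cb mu lam)]

/-! ### The traces through the chart -/

/-- **A TRACE THROUGH THE SLOT-`0` READING**: `ψ_l(λx₀, x₀(μ+x₁)) = x₀ · ψ'_{l⁺} + c_l x₀` (part 6's `X_one_mul_stepSeries₂`, variables
exchanged), for the successor trace `ψ'_{l⁺}` of the point move read at `a` (`(λ, μ) = (c_a, c_b)`, `l ≠ a`, `ψ_l(0) = 0`). -/
theorem subst_cb_ψ {σ : SurfDatum k m} {c : Fin (m + 1) → k} (G : MvPowerSeries (Fin (m + 1 + 1)) k) {l : Fin (m + 1)}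
    (hl : l ≠ σ.a) (h0 : constantCoeff (σ.ψ l) = 0) :
    subst (![C (c σ.a) * X 0, X 0 * (C (c σ.b) + X 1)] : Fin 2 → MvPowerSeries (Fin 2) k) (σ.ψ l) =
      X 0 * (σ.pointSucc c G).ψ (Fin.predAbove σ.a l.succ) + C (c l) * X 0 := by
  rw [pointSucc_ψ_predAbove σ c G hl]
  have h := congrArg (subst (![X 1, X 0] : Fin 2 → MvPowerSeries (Fin 2) k)) (X_one_mul_stepSeries₂ h0 (c σ.a) (c σ.b) (c l))
  rw [← coe_substAlgHom TOT2Curve.hasSubst_swap, map_mul, map_sub, map_mul, coe_substAlgHom,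
    subst_comp_subst_apply (hasSubst_chartBase (c σ.a) (c σ.b)) TOT2Curve.hasSubst_swap] at h
  simp only [subst_X TOT2Curve.hasSubst_swap, subst_C, Matrix.cons_val_one, Matrix.cons_val_zero] at h
  have hfam : (fun t : Fin 2 => subst (![X 1, X 0] : Fin 2 → MvPowerSeries (Fin 2) k)
      ((![C (c σ.a) * X 1, X 1 * (C (c σ.b) + X 0)] : Fin 2 → MvPowerSeries (Fin 2) k) t)) =
      (![C (c σ.a) * X 0, X 0 * (C (c σ.b) + X 1)] : Fin 2 → MvPowerSeries (Fin 2) k) := by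
    funext t
    fin_cases t
    · simp [subst_mul TOT2Curve.hasSubst_swap, subst_X TOT2Curve.hasSubst_swap, subst_C]
    · simp [subst_mul TOT2Curve.hasSubst_swap, subst_add TOT2Curve.hasSubst_swap, subst_X TOT2Curve.hasSubst_swap, subst_C]
  rw [hfam] at h
  rw [← sub_eq_iff_eq_add]
  exact h.symm

/-- The reading family kills no non-zero series (it is the chart of slope `μ/λ` followed by the scaling `(λx, λ⁻¹y)`). -/
theorem subst_cb_ne_zero {lam : k} (hlam : lam ≠ 0) (mu : k) {P : MvPowerSeries (Fin 2) k} (hP : P ≠ 0) :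
    subst (![C lam * X 0, X 0 * (C mu + X 1)] : Fin 2 → MvPowerSeries (Fin 2) k) P ≠ 0 := by
  have h := BlowupScaling.slice_zero_chart (c := ![lam, mu]) (by simpa using hlam) P
  rw [slice_zero_chart_eq] at h
  simp only [Matrix.cons_val_zero, Matrix.cons_val_one] at h
  rw [h]
  intro h0
  have h1 : C (1 : k) * subst (PlaneGerm.diagScale lam lam⁻¹) (subst (PlaneGerm.dirChart (mu / lam)) P) = 0 := by
    rw [h0, mul_zero]
  rw [BlowupScaling.scale_eq_zero_iff one_ne_zero hlam (inv_ne_zero hlam)] at h1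
  exact PlaneGerm.subst_dirChart_ne_zero (mu / lam) hP h1

/-! ### The successor's shadow divides `x₀ ·` the chart image of the shadow -/

open Classical in
/-- **THE SUCCESSOR'S SHADOW DIVIDES `x₀ · shadow(λx₀, x₀(μ+x₁))`** (point move read at `a`, tangent-plane answer with `c_a ≠ 0`). -/
theorem shadow_pointSucc_dvd {σ : SurfDatum k m} (hσ : σ.Valid) {c : Fin (m + 1) → k} (hca : c σ.a ≠ 0)
    (G : MvPowerSeries (Fin (m + 1 + 1)) k) :
    (σ.pointSucc c G).shadow ∣ X 0 * subst (![C (c σ.a) * X 0, X 0 * (C (c σ.b) + X 1)] : Fin 2 → MvPowerSeries (Fin 2) k) σ.shadow := by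
  obtain ⟨-, hab, hψ, -, -⟩ := hσ
  set φ : MvPowerSeries (Fin 2) k →ₐ[k] MvPowerSeries (Fin 2) k := substAlgHom (hasSubst_cb (c σ.a) (c σ.b)) with hφ
  have hφe : ∀ P, subst (![C (c σ.a) * X 0, X 0 * (C (c σ.b) + X 1)] : Fin 2 → MvPowerSeries (Fin 2) k) P = φ P :=
    fun P => by rw [hφ, coe_substAlgHom]
  set σ' := σ.pointSucc c G with hσ'
  -- the successor's shadow, factor by factor
  rw [shadow, shadow, hφe, map_mul, map_mul, map_pow, map_pow, map_prod]
  -- (1) the new first base letter `0` is a boundary letter: the factor `x₀`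
  rw [if_pos (a_mem_E_pointSucc σ c G), pow_one]
  -- (2) the second base letter
  have h2 : (X 1 : MvPowerSeries (Fin 2) k) ^ (if σ'.b ∈ σ'.δ.E then 1 else 0) ∣ φ (X 1) ^ (if σ.b ∈ σ.δ.E then 1 else 0) := by
    by_cases hb' : σ'.b ∈ σ'.δ.E
    · obtain ⟨hb, hcb⟩ := (b_mem_E_pointSucc_iff hab hca G).mp hb'
      rw [if_pos hb', if_pos hb, pow_one, pow_one, ← hφe, subst_X (hasSubst_cb _ _)]
      simp [hcb]
    · rw [if_neg hb', pow_zero]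
      exact one_dvd _
  -- (3) the off-base letters: re-index the successor's product over the old letters passing through the answer
  have hinj : Set.InjOn (fun l : Fin (m + 1) => Fin.predAbove σ.a l.succ)
      ((σ.off.filter fun l => c l = 0 ∧ σ'.ψ (Fin.predAbove σ.a l.succ) ≠ 0 : Finset (Fin (m + 1))) : Set (Fin (m + 1))) := by
    intro l hl l' hl' h
    have hla : l ≠ σ.a := fun h' => ((mem_off_iff σ l).mp (Finset.mem_filter.mp hl).1).2 (Or.inl h')
    have hl'a : l' ≠ σ.a := fun h' => ((mem_off_iff σ l').mp (Finset.mem_filter.mp hl').1).2 (Or.inl h')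
    exact predAbove_succ_injOn hla hl'a h
  have hS' : (σ'.off.filter fun l' => σ'.ψ l' ≠ 0) =
      (σ.off.filter fun l => c l = 0 ∧ σ'.ψ (Fin.predAbove σ.a l.succ) ≠ 0).image fun l => Fin.predAbove σ.a l.succ := by
    rw [hσ', off_pointSucc_eq_image hab hca, Finset.filter_image, Finset.filter_filter]
  have h3 : ∏ l' ∈ σ'.off.filter (fun l' => σ'.ψ l' ≠ 0), σ'.ψ l' ∣ ∏ l ∈ σ.off.filter (fun l => σ.ψ l ≠ 0), φ (σ.ψ l) := by
    rw [hS', Finset.prod_image hinj]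
    refine (Finset.prod_dvd_prod_of_dvd _ _ fun l hl => ?_).trans (Finset.prod_dvd_prod_of_subset _ _ _ fun l hl => ?_)
    · -- each surviving trace divides the chart image of the old trace: `φ ψ_l = x₀ ψ'_{l⁺}` (`c_l = 0`)
      obtain ⟨hlo, hcl, -⟩ := Finset.mem_filter.mp hl
      obtain ⟨-, hlab⟩ := (mem_off_iff σ l).mp hlo
      have hla : l ≠ σ.a := fun h' => hlab (Or.inl h')
      show σ'.ψ (Fin.predAbove σ.a l.succ) ∣ φ (σ.ψ l)
      rw [← hφe, subst_cb_ψ G hla (hψ l hlab), hcl, map_zero, zero_mul, add_zero]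
      exact Dvd.intro_left _ rfl
    · -- and a surviving non-zero trace comes from a non-zero trace
      obtain ⟨hlo, hcl, hne⟩ := Finset.mem_filter.mp hl
      obtain ⟨-, hlab⟩ := (mem_off_iff σ l).mp hlo
      have hla : l ≠ σ.a := fun h' => hlab (Or.inl h')
      refine Finset.mem_filter.mpr ⟨hlo, fun h0 => hne ?_⟩
      have h := subst_cb_ψ G hla (hψ l hlab) (c := c)
      rw [h0, hcl, map_zero, zero_mul, add_zero, ← coe_substAlgHom (hasSubst_cb _ _), map_zero] at h
      exact (mul_eq_zero.mp h.symm).resolve_left (FormalCoordChange.X_ne_zero' _)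
  -- assemble
  calc X 0 * X 1 ^ (if σ'.b ∈ σ'.δ.E then 1 else 0) * ∏ l' ∈ σ'.off.filter (fun l' => σ'.ψ l' ≠ 0), σ'.ψ l'
      ∣ X 0 * φ (X 1) ^ (if σ.b ∈ σ.δ.E then 1 else 0) * ∏ l ∈ σ.off.filter (fun l => σ.ψ l ≠ 0), φ (σ.ψ l) :=
        mul_dvd_mul (mul_dvd_mul (dvd_refl _) h2) h3
    _ ∣ X 0 * (φ (X 0) ^ (if σ.a ∈ σ.δ.E then 1 else 0) * φ (X 1) ^ (if σ.b ∈ σ.δ.E then 1 else 0) *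
        ∏ l ∈ σ.off.filter (fun l => σ.ψ l ≠ 0), φ (σ.ψ l)) :=
        ⟨φ (X 0) ^ (if σ.a ∈ σ.δ.E then 1 else 0), by ring⟩


/-! ### The count drops -/

/-- Slicing the `s`-saturated plane chart transform at the slot `0`. -/
theorem slice_zero_factor {P : MvPowerSeries (Fin 2) k} {cb : Fin 2 → k} {A : ℕ} {G₃ : MvPowerSeries (Fin 3) k}
    (hfac : subst (CobordantChart.chart (fun _ : Fin 2 => 1) cb) P = X 0 ^ A * G₃) :
    subst (![C (cb 0) * X 0, X 0 * (C (cb 1) + X 1)] : Fin 2 → MvPowerSeries (Fin 2) k) P =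
      X 0 ^ A * subst (fun j : Fin 3 => if j = (0 : Fin 2).succ then (0 : MvPowerSeries (Fin 2) k) else X (Fin.predAbove 0 j)) G₃ := by
  have hS := CobordantChartPlaneSlice.hasSubst_slice (R := k) (0 : Fin 2)
  have h := congrArg (subst (fun j : Fin 3 => if j = (0 : Fin 2).succ then (0 : MvPowerSeries (Fin 2) k) else X (Fin.predAbove 0 j))) hfac
  rw [slice_zero_chart_eq, subst_mul hS, subst_pow hS, subst_X hS] at h
  simpa using h

/-- Slicing the `s`-saturated plane chart transform at the slot `1`. -/
theorem slice_one_factor {P : MvPowerSeries (Fin 2) k} {cb : Fin 2 → k} {A : ℕ} {G₃ : MvPowerSeries (Fin 3) k}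
    (hfac : subst (CobordantChart.chart (fun _ : Fin 2 => 1) cb) P = X 0 ^ A * G₃) :
    subst (![X 0 * (C (cb 0) + X 1), C (cb 1) * X 0] : Fin 2 → MvPowerSeries (Fin 2) k) P =
      X 0 ^ A * subst (fun j : Fin 3 => if j = (1 : Fin 2).succ then (0 : MvPowerSeries (Fin 2) k) else X (Fin.predAbove 1 j)) G₃ := by
  have hS := CobordantChartPlaneSlice.hasSubst_slice (R := k) (1 : Fin 2)
  have h := congrArg (subst (fun j : Fin 3 => if j = (1 : Fin 2).succ then (0 : MvPowerSeries (Fin 2) k) else X (Fin.predAbove 1 j))) hfac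
  rw [slice_one_chart_eq, subst_mul hS, subst_pow hS, subst_X hS] at h
  simpa using h

/-- `x₀^A · D ∣ D^{A+1}` when `x₀ ∣ D`. -/
theorem X_pow_mul_dvd_pow_succ {A : ℕ} {D S : MvPowerSeries (Fin 2) k} (hD : D = X 0 * S) : X 0 ^ A * D ∣ D ^ (A + 1) := by
  rw [pow_succ]
  exact mul_dvd_mul (pow_dvd_pow_of_dvd ⟨S, hD⟩ A) dvd_rfl

/-- **READING AT `a`: the successor's shadow divides a power of the slot-`0` slice germ** of the plane chart of the shadow at `(c_a, c_b)`. -/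
theorem shadow_pointSucc_dvd_pow {σ : SurfDatum k m} (hσ : σ.Valid) {c : Fin (m + 1) → k} (hca : c σ.a ≠ 0)
    (G : MvPowerSeries (Fin (m + 1 + 1)) k) {A : ℕ} {G₃ : MvPowerSeries (Fin 3) k}
    (hfac : subst (CobordantChart.chart (fun _ : Fin 2 => 1) ![c σ.a, c σ.b]) σ.shadow = X 0 ^ A * G₃) :
    (σ.pointSucc c G).shadow ∣
      (X 0 * subst (fun j : Fin 3 => if j = (0 : Fin 2).succ then (0 : MvPowerSeries (Fin 2) k) else X (Fin.predAbove 0 j)) G₃) ^ (A + 1) := by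
  have h1 := shadow_pointSucc_dvd hσ hca G
  have h2 := slice_zero_factor hfac
  simp only [Matrix.cons_val_zero, Matrix.cons_val_one] at h2
  rw [h2, ← mul_assoc, mul_comm (X 0) (X 0 ^ A), mul_assoc] at h1
  exact h1.trans (X_pow_mul_dvd_pow_succ rfl)

/-- **READING AT `b`: the successor's shadow divides a power of the slot-`1` slice germ.** -/
theorem shadow_swap_pointSucc_dvd_pow {σ : SurfDatum k m} (hσ : σ.Valid) {c : Fin (m + 1) → k} (hcb : c σ.b ≠ 0)
    (G : MvPowerSeries (Fin (m + 1 + 1)) k) {A : ℕ} {G₃ : MvPowerSeries (Fin 3) k}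
    (hfac : subst (CobordantChart.chart (fun _ : Fin 2 => 1) ![c σ.a, c σ.b]) σ.shadow = X 0 ^ A * G₃) :
    (σ.swap.pointSucc c G).shadow ∣
      (X 0 * subst (fun j : Fin 3 => if j = (1 : Fin 2).succ then (0 : MvPowerSeries (Fin 2) k) else X (Fin.predAbove 1 j)) G₃) ^ (A + 1) := by
  have h1 := shadow_pointSucc_dvd hσ.swap (c := c) hcb G
  have h2 := slice_one_factor hfac
  simp only [Matrix.cons_val_zero, Matrix.cons_val_one] at h2
  rw [swap_a, swap_bLetter, shadow_swap, ← subst_cbOne_eq_subst_cb_swap, h2, ← mul_assoc, mul_comm (X 0) (X 0 ^ A), mul_assoc] at h1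
  exact h1.trans (X_pow_mul_dvd_pow_succ rfl)

/-- **THE POINT MOVE OF THE NON-NORMAL-CROSSING PHASE** (OURS · L1 W4.3, memo §1).  Let `ν` be a radical-monotone count of non-normal-crossing
infinitely near points of plane germs dropping at every point of the first blow-up (`PlaneGermNonNCCountRad`, a theorem of the tree:
`stub_planeCountRadical`).  From a valid loop state whose shadow is NOT a normal crossing, the identity point move satisfies the count game's move clause
for the goal «admissibly decorated, and: the head dropped, or same head, a valid loop state, and SMALLER `ν` OF THE SHADOW» — reading each answer at
the slot `ν`'s drop clause names. -/
theorem pointMove_clause_shadow [Infinite k] (ν : MvPowerSeries (Fin 2) k → ℕ)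
    (hν₂ : ∀ b d : MvPowerSeries (Fin 2) k, d ≠ 0 → ∀ N : ℕ, b ∣ d ^ (N + 1) → ν b ≤ ν d)
    (hν₃ : ∀ b : MvPowerSeries (Fin 2) k, b ≠ 0 → ¬ PlaneGerm.IsNC b →
      ∀ c : Fin 2 → k, c ≠ 0 → ∀ (a : ℕ) (G : MvPowerSeries (Fin 3) k),
        MvPowerSeries.subst (CobordantChart.chart (fun _ : Fin 2 => 1) c) b = MvPowerSeries.X 0 ^ a * G →
        ¬ (MvPowerSeries.X (0 : Fin 3) ∣ G) →
        ∃ i : Fin 2, c i ≠ 0 ∧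
          ν (MvPowerSeries.X 0 * MvPowerSeries.subst (fun j : Fin 3 => if j = i.succ then (0 : MvPowerSeries (Fin 2) k)
                else MvPowerSeries.X (Fin.predAbove i j)) G) < ν b)
    {σ : SurfDatum k m} (hσ : σ.Valid) (hnc : ¬ PlaneGerm.IsNC σ.shadow) :
    MoveClause σ.b₀ (fun j => (X j : MvPowerSeries (Fin (m + 1)) k)) (fun _ => 1)
      (fun b' => ∃ σ' : SurfDatum k m, σ'.b₀ = b' ∧ Admissible σ'.b₀ σ'.δ ∧
        (σ'.δ.head < σ.δ.head ∨ (σ'.δ.head = σ.δ.head ∧ σ'.Valid ∧ ν σ'.shadow < ν σ.shadow))) := by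
  classical
  have hf : σ.δ.f ≠ 0 := hσ.1.2.1.ne_zero
  have hpermX := isBPermissible_point_X σ.δ
  have hconv : ∀ (c : Fin (m + 1) → k) (l : Fin (m + 1)), (fun _ : Fin (m + 1) => (1 : ℕ)) l = 0 → c l = 0 :=
    fun _ _ h => absurd h one_ne_zero
  intro c hc0 hcne A G hfacX hG
  have hfac : subst (CobordantChart.chart (fun _ : Fin (m + 1) => 1) c) σ.b₀ = X 0 ^ A * G := by
    rw [show subst (fun j => (X j : MvPowerSeries (Fin (m + 1)) k)) σ.b₀ = σ.b₀ from congrFun subst_self _] at hfacX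
    exact hfacX
  have hgen : ∀ s, c s ≠ 0 →
      Admissible (X 0 * TupleGame.slice s G) (σ.δ.transform (fun j => (X j : MvPowerSeries (Fin (m + 1)) k)) (fun _ => 1) c s) ∧
        (σ.δ.transform (fun j => (X j : MvPowerSeries (Fin (m + 1)) k)) (fun _ => 1) c s).head ≤ σ.δ.head := fun s hs =>
    ⟨admissible_transform hσ.1 hpermX (hconv c) hfacX hG hs, Decoration.head_transform_le hpermX (hconv c) hf hs⟩
  -- any live slot: if the head dropped there, done
  obtain ⟨s₀, hs₀⟩ : ∃ s, c s ≠ 0 := Function.ne_iff.mp hcne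
  by_cases hlt₀ : (σ.δ.transform (fun j => (X j : MvPowerSeries (Fin (m + 1)) k)) (fun _ => 1) c s₀).head < σ.δ.head
  · exact ⟨s₀, hs₀, ⟨X 0 * TupleGame.slice s₀ G, _, σ.a, σ.b, σ.ψ⟩, rfl, (hgen s₀ hs₀).1, Or.inl hlt₀⟩
  have hhead₀ : (σ.δ.transform (fun j => (X j : MvPowerSeries (Fin (m + 1)) k)) (fun _ => 1) c s₀).head = σ.δ.head :=
    le_antisymm (hgen s₀ hs₀).2 (not_lt.mp hlt₀)
  obtain ⟨hc', hab0⟩ := tangent_of_head_eq hσ hs₀ hhead₀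
  -- the plane chart of the shadow at `(c_a, c_b)` and the slot the count drops at
  have hsh : σ.shadow ≠ 0 := shadow_ne_zero σ
  have hcb0 : (![c σ.a, c σ.b] : Fin 2 → k) ≠ 0 := by
    intro h
    rcases hab0 with h' | h'
    · exact h' (by simpa using congrFun h 0)
    · exact h' (by simpa using congrFun h 1)
  obtain ⟨A₃, G₃, hfac₃, hG₃⟩ := CobordantVertexChart.exists_eq_X_pow_mul_not_dvd
    (CobordantChart.subst_chart_ne_zero (fun _ : Fin 2 => 1) ![c σ.a, c σ.b] (BlowupScaling.chart_convention _) hsh)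
  obtain ⟨i, hci, hνlt⟩ := hν₃ σ.shadow hsh hnc ![c σ.a, c σ.b] hcb0 A₃ G₃ hfac₃ hG₃
  -- the slice germ is non-zero
  have hD0 : ∀ i : Fin 2, X 0 ^ A₃ * subst (fun j : Fin 3 => if j = i.succ then (0 : MvPowerSeries (Fin 2) k) else X (Fin.predAbove i j)) G₃ ≠ 0 →
      X 0 * subst (fun j : Fin 3 => if j = i.succ then (0 : MvPowerSeries (Fin 2) k) else X (Fin.predAbove i j)) G₃ ≠ 0 := by
    intro i h
    exact mul_ne_zero (FormalCoordChange.X_ne_zero' _) (right_ne_zero_of_mul h)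
  fin_cases i
  · -- slot `a`
    have hca : c σ.a ≠ 0 := by simpa using hci
    set σ' := σ.pointSucc c G with hσ'
    refine ⟨σ.a, hca, σ', rfl, admissible_pointSucc hσ hfac hG hca, ?_⟩
    by_cases hlt : σ'.δ.head < σ.δ.head
    · exact Or.inl hlt
    have hhead : σ'.δ.head = σ.δ.head := le_antisymm (head_pointSucc_le hσ c G hca) (not_lt.mp hlt)
    refine Or.inr ⟨hhead, valid_pointSucc hσ hc' hca hfac hG hhead, lt_of_le_of_lt (hν₂ _ _ (hD0 0 ?_) A₃ ?_) hνlt⟩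
    · have h2 := slice_zero_factor hfac₃
      simp only [Matrix.cons_val_zero, Matrix.cons_val_one] at h2
      rw [← h2]
      exact subst_cb_ne_zero hca _ hsh
    · exact shadow_pointSucc_dvd_pow hσ hca G hfac₃
  · -- slot `b`: read the swapped state
    have hcb : c σ.b ≠ 0 := by simpa using hci
    set σ' := σ.swap.pointSucc c G with hσ'
    refine ⟨σ.b, hcb, σ', rfl, admissible_pointSucc hσ.swap hfac hG hcb, ?_⟩
    by_cases hlt : σ'.δ.head < σ.δ.head
    · exact Or.inl hlt
    have hhead : σ'.δ.head = σ.δ.head := le_antisymm (head_pointSucc_le hσ.swap c G hcb) (not_lt.mp hlt)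
    refine Or.inr ⟨hhead, valid_pointSucc hσ.swap (eq_combo_tangent_swap hσ.2.1 hc') hcb hfac hG hhead,
      lt_of_le_of_lt (hν₂ _ _ (hD0 1 ?_) A₃ ?_) hνlt⟩
    · have h2 := slice_one_factor hfac₃
      simp only [Matrix.cons_val_zero, Matrix.cons_val_one] at h2
      rw [← h2, subst_cbOne_eq_subst_cb_swap, ← shadow_swap]
      exact subst_cb_ne_zero hcb _ (shadow_ne_zero σ.swap)
    · exact shadow_swap_pointSucc_dvd_pow hσ hcb G hfac₃


/-! ### The non-normal-crossing phase -/

/-- **THE NON-NORMAL-CROSSING PHASE OF THE LOOP** (OURS · L1 W4.3, memo §1): from every valid loop state the mover forces «admissibly decorated of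
smaller head, or a valid loop state of the same head whose SHADOW IS A NORMAL CROSSING» — point moves only, measure `ν(shadow)`. -/
theorem dWinsTo_ncShadow [Infinite k] (ν : MvPowerSeries (Fin 2) k → ℕ)
    (hν₂ : ∀ b d : MvPowerSeries (Fin 2) k, d ≠ 0 → ∀ N : ℕ, b ∣ d ^ (N + 1) → ν b ≤ ν d)
    (hν₃ : ∀ b : MvPowerSeries (Fin 2) k, b ≠ 0 → ¬ PlaneGerm.IsNC b →
      ∀ c : Fin 2 → k, c ≠ 0 → ∀ (a : ℕ) (G : MvPowerSeries (Fin 3) k),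
        MvPowerSeries.subst (CobordantChart.chart (fun _ : Fin 2 => 1) c) b = MvPowerSeries.X 0 ^ a * G →
        ¬ (MvPowerSeries.X (0 : Fin 3) ∣ G) →
        ∃ i : Fin 2, c i ≠ 0 ∧
          ν (MvPowerSeries.X 0 * MvPowerSeries.subst (fun j : Fin 3 => if j = i.succ then (0 : MvPowerSeries (Fin 2) k)
                else MvPowerSeries.X (Fin.predAbove i j)) G) < ν b)
    {σ₀ : SurfDatum k m} (hσ₀ : σ₀.Valid) :
    DWinsTo (St := SurfDatum k m) SurfDatum.b₀
      (fun τ => (Admissible τ.b₀ τ.δ ∧ τ.δ.head < σ₀.δ.head) ∨ (τ.Valid ∧ τ.δ.head = σ₀.δ.head ∧ PlaneGerm.IsNC τ.shadow)) σ₀ := by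
  refine DWinsTo.of_wfMeasure (germ := SurfDatum.b₀) {τ : SurfDatum k m | τ.Valid ∧ τ.δ.head = σ₀.δ.head} wellFounded_lt
    (fun τ => ν τ.shadow) (fun τ hτ hQ => ?_) ⟨hσ₀, rfl⟩
  obtain ⟨hτ, hhead⟩ := hτ
  have hnc : ¬ PlaneGerm.IsNC τ.shadow := fun h => hQ (Or.inr ⟨hτ, hhead, h⟩)
  refine ⟨fun j => X j, fun _ => 1, (isBPermissible_point_X τ.δ).1, (pointMove_clause_shadow ν hν₂ hν₃ hτ hnc).mono fun b' => ?_⟩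
  rintro ⟨σ', hb', hadm', h⟩
  refine ⟨σ', hb', ?_⟩
  rcases h with hlt | ⟨heq, hval, hνlt⟩
  · exact Or.inl (Or.inl ⟨hadm', lt_of_lt_of_eq hlt hhead⟩)
  · exact Or.inr ⟨⟨hval, heq.trans hhead⟩, hνlt⟩


end SurfDatum

end GraphSurf

end TameFourTupleDrop

end Summit.ResolutionOfSingularities.ResolutionOfSingularities.Theorems

end
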